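import Mathlib
import Summits.Ventures.PercRepro2.Defs
import Summits.Ventures.PercRepro2.Harris
import Summits.Ventures.PercRepro2.CoinDefs
import Summits.Ventures.PercRepro2.CoinReverse
import Summits.Ventures.PercRepro2.CoinStarDefs
import Summits.Ventures.PercRepro2.CoinLsmCoreDefs
import Summits.Ventures.PercRepro2.CoinLsmCoreU
import Summits.Ventures.PercRepro2.CoinCoreGate
import Summits.Ventures.PercRepro2.CoinOrTailAlg
import Summits.Ventures.PercRepro2.CoinOrTailBlockSums
import Summits.Ventures.PercRepro2.CoinBlockTheoremII
import Summits.Ventures.PercRepro2.CoinBlockMeanOrder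
import Summits.Ventures.PercRepro2.CoinLsmCoreSure
import Summits.Ventures.PercRepro2.CoinMixBlock
import Summits.Ventures.PercRepro2.CoinOrTailKOneAlg
import Summits.Ventures.PercRepro2.CoinOrTailKChainAlg
import Summits.Ventures.PercRepro2.CoinOrTailKChainFunctional

/-!
# Row 2′DARC over a log-supermodular core for a free arc at ANY vertex of the core, any two markers,
no non-degeneracy (blind cell PercRepro2, night-2 g11; proofs/NIGHT2-DARC.md §44)

`darc_of_lsmCoreAny`: a closed-in core `C` (pairs at the root allowed) with a log-supermodular
cluster law (`hν`, all pairs), the free arc `u → w` with `u ∈ C` ANY vertex of the core, and ANY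
two markers `a, b ∈ C`: `Φ_D({s ↛ t in D + (u → w)}) ≥ 0` at every head, for every probability
vector, with NO non-degeneracy hypothesis.  Under the full log-supermodularity hypothesis this
removes the two positivity hypotheses of g7's `darc_of_uCellLsmU` (which needs log-supermodularity
only on the `u`-present cell, but both `u`-cells of positive mass) and the sure-vertex hypothesis
of g10's `darc_of_lsmCoreSure`, settling the «mixed-degenerate case» left open in §40.9.

Proof: split every cluster by `u ∈ W`.  The `u`-absent part is a trivially covered block system
(gate value = `R`-value, so `M = Λ` on every block); the `u`-present part is a sure system with the
gate `A (insert w W)`, log-supermodular and in the Holley order above both parts (one lsm step of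
`A`).  The mixed block theorem `mixBlock_nonneg` closes — the same mechanism as the OR-tail with an
undominated entry (§43), with the indicator `1[u ∈ W]` in place of the effective entry coin.
-/

namespace Summit.Ventures.PercRepro2.Coin

open Classical

section AnyArc

variable {V : Type*} {E : Type*} [Fintype V] [DecidableEq V] [Fintype E] [DecidableEq E]
  {R : Type*} [Field R] [LinearOrder R] [IsStrictOrderedRing R]
  {arcs : E → Finset (V × V)} {s : V} {C : Finset V}

/-- **THEOREM (row 2′DARC over a log-supermodular core, the free arc at ANY core vertex, any
markers, no non-degeneracy).**  `ClosedInCoreU arcs s C`, `SameEnds`, the cluster law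
log-supermodular (`hν`), `u ∈ C`, markers `a, b ∈ C`, `t ∉ C`, `t ≠ s`, `w ≠ s`, `w ∉ C` ⟹
`Φ_D({s ↛ t in D + (u → w)}) ≥ 0`. -/
theorem darc_of_lsmCoreAny (pr : E → R) (hp : IsProbVec pr) (hS : SameEnds arcs)
    (h : ClosedInCoreU arcs s C) {t : V} (htC : t ∉ C) (hts : t ≠ s) {a b u w : V}
    (ha : a ∈ C) (hb : b ∈ C) (hu : u ∈ C) (hws : w ≠ s) (hwC : w ∉ C)
    (hν : ∀ W W', W ⊆ C → W' ⊆ C →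
      prob pr (coreLevel arcs s C W) * prob pr (coreLevel arcs s C W') ≤
        prob pr (coreLevel arcs s C (W ∩ W')) * prob pr (coreLevel arcs s C (W ∪ W'))) :
    DARC pr arcs s {t} a b u w := by
  unfold DARC
  rw [h.phiC_gate_eq pr hS htC hts ha hb hu hws hwC]
  obtain ⟨hA0, hAmono, hAlsm⟩ := core_head_props (C := C) (s := s) pr hp hS t
  set ν : Finset V → R := fun W => prob pr (coreLevel arcs s C W) with hνdef
  set A : Finset V → R := fun X => prob pr (coreAvoidEvent arcs s t C X) with hAdef
  set G : Finset V → R := fun W => A (starTarget u w W) with hGdef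
  have hν0 : ∀ W, 0 ≤ ν W := fun W => prob_nonneg hp _
  -- the indicator coin of `u` (the coin factors of `CoinOrTailKOneAlg` with `p = 1`)
  set cC : Finset V → R := fun W => 1 - (1 : R) * (if u ∈ W then 1 else 0) with hcC
  set cO : Finset V → R := fun W => (1 : R) * (if u ∈ W then 1 else 0) with hcO
  have hcC0 : ∀ W, 0 ≤ cC W := fun W => coinClosed_nonneg (le_refl (1 : R)) u W
  have hcO0 : ∀ W, 0 ≤ cO W := fun W => coinOpen_nonneg zero_le_one u W
  set Aw : Finset V → R := fun W => A (insert w W) with hAw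
  have hAw0 : ∀ W, 0 ≤ Aw W := fun W => hA0 _
  -- the pointwise splits of the `R`-weight and of the gate weight
  have hsplitR : ∀ W, ν W * A W = ν W * cC W * A W + ν W * cO W * A W := by
    intro W; simp only [hcC, hcO]; ring
  have hsplitG : ∀ W, ν W * G W = ν W * cC W * A W + ν W * cO W * Aw W := by
    intro W
    simp only [hcC, hcO, hGdef, hAw, starTarget]
    by_cases huW : u ∈ W <;> simp [huW]
  -- the value steps
  have hAwA : ∀ s' ⊆ C, ∀ t' ⊆ C, Aw s' * A t' ≤ A (s' ∩ t') * Aw (s' ∪ t') := by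
    intro s' _ t' ht'
    have hwt : w ∉ t' := fun hw => hwC (ht' hw)
    have hI : insert w s' ∩ t' = s' ∩ t' := by
      ext x
      simp only [Finset.mem_inter, Finset.mem_insert]
      constructor
      · rintro ⟨hx | hx, hxt⟩
        · exact absurd (hx ▸ hxt) hwt
        · exact ⟨hx, hxt⟩
      · rintro ⟨hx, hxt⟩; exact ⟨Or.inr hx, hxt⟩
    have hU : insert w s' ∪ t' = insert w (s' ∪ t') := Finset.insert_union w s' t'
    have hl := hAlsm (insert w s') t'
    rw [hI, hU] at hl
    exact hl
  have hAwAw : ∀ s' t' : Finset V, Aw s' * Aw t' ≤ Aw (s' ∩ t') * Aw (s' ∪ t') := by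
    intro s' t'
    have hI : insert w s' ∩ insert w t' = insert w (s' ∩ t') :=
      (Finset.insert_inter_distrib s' t' w).symm
    have hU : insert w s' ∪ insert w t' = insert w (s' ∪ t') :=
      (Finset.insert_union_distrib w s' t').symm
    have hl := hAlsm (insert w s') (insert w t')
    rw [hI, hU] at hl
    exact hl
  -- the four weights
  have hLw0 : ∀ W, 0 ≤ ν W * cC W * A W := fun W =>
    mul_nonneg (mul_nonneg (hν0 W) (hcC0 W)) (hA0 W)
  have hKw0 : ∀ W, 0 ≤ ν W * cO W * A W := fun W =>
    mul_nonneg (mul_nonneg (hν0 W) (hcO0 W)) (hA0 W)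
  have hNw0 : ∀ W, 0 ≤ ν W * cO W * Aw W := fun W =>
    mul_nonneg (mul_nonneg (hν0 W) (hcO0 W)) (hAw0 W)
  -- the pointwise lattice steps
  have pLL : ∀ s' ⊆ C, ∀ t' ⊆ C, ν s' * cC s' * A s' * (ν t' * cC t' * A t') ≤
      ν (s' ∩ t') * cC (s' ∩ t') * A (s' ∩ t') * (ν (s' ∪ t') * cC (s' ∪ t') * A (s' ∪ t')) :=
    fun s' hs' t' ht' => three_step (hν s' t' hs' ht')
      (le_of_eq (coinClosed_mul_coinClosed (1 : R) u s' t')) (hAlsm s' t') (hν0 _) (hν0 _)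
      (hcC0 _) (hcC0 _) (hcC0 _) (hcC0 _) (hA0 _) (hA0 _)
  have pLK : ∀ s' ⊆ C, ∀ t' ⊆ C, ν s' * cC s' * A s' * (ν t' * cO t' * A t') ≤
      ν (s' ∩ t') * cC (s' ∩ t') * A (s' ∩ t') * (ν (s' ∪ t') * cO (s' ∪ t') * A (s' ∪ t')) :=
    fun s' hs' t' ht' => three_step (hν s' t' hs' ht')
      (coinClosed_mul_coinOpen_le zero_le_one u s' t') (hAlsm s' t') (hν0 _) (hν0 _)
      (hcC0 _) (hcO0 _) (hcC0 _) (hcO0 _) (hA0 _) (hA0 _)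
  have pKK : ∀ s' ⊆ C, ∀ t' ⊆ C, ν s' * cO s' * A s' * (ν t' * cO t' * A t') ≤
      ν (s' ∩ t') * cO (s' ∩ t') * A (s' ∩ t') * (ν (s' ∪ t') * cO (s' ∪ t') * A (s' ∪ t')) :=
    fun s' hs' t' ht' => three_step (hν s' t' hs' ht')
      (le_of_eq (coinOpen_mul_coinOpen (1 : R) u s' t')) (hAlsm s' t') (hν0 _) (hν0 _)
      (hcO0 _) (hcO0 _) (hcO0 _) (hcO0 _) (hA0 _) (hA0 _)
  have pNN : ∀ s' ⊆ C, ∀ t' ⊆ C, ν s' * cO s' * Aw s' * (ν t' * cO t' * Aw t') ≤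
      ν (s' ∩ t') * cO (s' ∩ t') * Aw (s' ∩ t') * (ν (s' ∪ t') * cO (s' ∪ t') * Aw (s' ∪ t')) :=
    fun s' hs' t' ht' => three_step (hν s' t' hs' ht')
      (le_of_eq (coinOpen_mul_coinOpen (1 : R) u s' t')) (hAwAw s' t') (hν0 _) (hν0 _)
      (hcO0 _) (hcO0 _) (hcO0 _) (hcO0 _) (hAw0 _) (hAw0 _)
  have pNL : ∀ s' ⊆ C, ∀ t' ⊆ C, ν s' * cO s' * Aw s' * (ν t' * cC t' * A t') ≤
      ν (s' ∩ t') * cC (s' ∩ t') * A (s' ∩ t') * (ν (s' ∪ t') * cO (s' ∪ t') * Aw (s' ∪ t')) :=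
    fun s' hs' t' ht' => three_step (hν s' t' hs' ht')
      (coinOpen_mul_coinClosed_le zero_le_one u s' t') (hAwA s' hs' t' ht') (hν0 _) (hν0 _)
      (hcO0 _) (hcC0 _) (hcC0 _) (hcO0 _) (hAw0 _) (hA0 _)
  have pNK : ∀ s' ⊆ C, ∀ t' ⊆ C, ν s' * cO s' * Aw s' * (ν t' * cO t' * A t') ≤
      ν (s' ∩ t') * cO (s' ∩ t') * A (s' ∩ t') * (ν (s' ∪ t') * cO (s' ∪ t') * Aw (s' ∪ t')) :=
    fun s' hs' t' ht' => three_step (hν s' t' hs' ht')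
      (le_of_eq (coinOpen_mul_coinOpen (1 : R) u s' t')) (hAwA s' hs' t' ht') (hν0 _) (hν0 _)
      (hcO0 _) (hcO0 _) (hcO0 _) (hcO0 _) (hAw0 _) (hA0 _)
  -- the block sums
  set L : Bool → Bool → R :=
    fun b₁ b₂ => ∑ W ∈ C.powerset, ν W * cC W * A W * cellWt a b b₁ b₂ W with hLdef
  set K : Bool → Bool → R :=
    fun b₁ b₂ => ∑ W ∈ C.powerset, ν W * cO W * A W * cellWt a b b₁ b₂ W with hKdef
  set N : Bool → Bool → R :=
    fun b₁ b₂ => ∑ W ∈ C.powerset, ν W * cO W * Aw W * cellWt a b b₁ b₂ W with hNdef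
  have hL0 : ∀ b₁ b₂, 0 ≤ L b₁ b₂ := fun b₁ b₂ =>
    Finset.sum_nonneg fun W _ => mul_nonneg (hLw0 W) (cellWt_nonneg _ _ _ _ _)
  have hK0 : ∀ b₁ b₂, 0 ≤ K b₁ b₂ := fun b₁ b₂ =>
    Finset.sum_nonneg fun W _ => mul_nonneg (hKw0 W) (cellWt_nonneg _ _ _ _ _)
  have hN0 : ∀ b₁ b₂, 0 ≤ N b₁ b₂ := fun b₁ b₂ =>
    Finset.sum_nonneg fun W _ => mul_nonneg (hNw0 W) (cellWt_nonneg _ _ _ _ _)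
  have H1 : L true false * L false true ≤ L false false * L true true := by
    have := cellBlock_mul_le C (fun W => ν W * cC W * A W) (fun W => ν W * cC W * A W)
      (fun W => ν W * cC W * A W) (fun W => ν W * cC W * A W) a b true false false true
      hLw0 hLw0 hLw0 hLw0 pLL
    simpa only [Bool.true_and, Bool.and_true, Bool.false_or, Bool.or_false] using this
  have X1a : L true false * K false true ≤ L false false * K true true := by
    have := cellBlock_mul_le C (fun W => ν W * cC W * A W) (fun W => ν W * cO W * A W)
      (fun W => ν W * cC W * A W) (fun W => ν W * cO W * A W) a b true false false true
      hLw0 hKw0 hLw0 hKw0 pLK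
    simpa only [Bool.true_and, Bool.and_true, Bool.false_or, Bool.or_false] using this
  have X1b : L false true * K true false ≤ L false false * K true true := by
    have := cellBlock_mul_le C (fun W => ν W * cC W * A W) (fun W => ν W * cO W * A W)
      (fun W => ν W * cC W * A W) (fun W => ν W * cO W * A W) a b false true true false
      hLw0 hKw0 hLw0 hKw0 pLK
    simpa only [Bool.true_and, Bool.and_true, Bool.false_or, Bool.or_false, Bool.false_and,
      Bool.and_false, Bool.true_or, Bool.or_true] using this
  have X2a : L true false * K false false ≤ L false false * K true false := by
    have := cellBlock_mul_le C (fun W => ν W * cC W * A W) (fun W => ν W * cO W * A W)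
      (fun W => ν W * cC W * A W) (fun W => ν W * cO W * A W) a b true false false false
      hLw0 hKw0 hLw0 hKw0 pLK
    simpa only [Bool.true_and, Bool.and_true, Bool.false_or, Bool.or_false, Bool.false_and,
      Bool.and_false, Bool.true_or, Bool.or_true] using this
  have X2b : L false true * K false false ≤ L false false * K false true := by
    have := cellBlock_mul_le C (fun W => ν W * cC W * A W) (fun W => ν W * cO W * A W)
      (fun W => ν W * cC W * A W) (fun W => ν W * cO W * A W) a b false true false false
      hLw0 hKw0 hLw0 hKw0 pLK
    simpa only [Bool.true_and, Bool.and_true, Bool.false_or, Bool.or_false, Bool.false_and,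
      Bool.and_false, Bool.true_or, Bool.or_true] using this
  have H1K : K true false * K false true ≤ K false false * K true true := by
    have := cellBlock_mul_le C (fun W => ν W * cO W * A W) (fun W => ν W * cO W * A W)
      (fun W => ν W * cO W * A W) (fun W => ν W * cO W * A W) a b true false false true
      hKw0 hKw0 hKw0 hKw0 pKK
    simpa only [Bool.true_and, Bool.and_true, Bool.false_or, Bool.or_false] using this
  have H2N : N true false * N false true ≤ N false false * N true true := by
    have := cellBlock_mul_le C (fun W => ν W * cO W * Aw W) (fun W => ν W * cO W * Aw W)
      (fun W => ν W * cO W * Aw W) (fun W => ν W * cO W * Aw W) a b true false false true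
      hNw0 hNw0 hNw0 hNw0 pNN
    simpa only [Bool.true_and, Bool.and_true, Bool.false_or, Bool.or_false] using this
  have holNL : ∀ b₁ b₂ b₁' b₂' : Bool, N b₁ b₂ * L b₁' b₂' ≤
      L (b₁ && b₁') (b₂ && b₂') * N (b₁ || b₁') (b₂ || b₂') := fun b₁ b₂ b₁' b₂' =>
    cellBlock_mul_le C (fun W => ν W * cO W * Aw W) (fun W => ν W * cC W * A W)
      (fun W => ν W * cC W * A W) (fun W => ν W * cO W * Aw W) a b b₁ b₂ b₁' b₂'
      hNw0 hLw0 hLw0 hNw0 pNL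
  have holNK : ∀ b₁ b₂ b₁' b₂' : Bool, N b₁ b₂ * K b₁' b₂' ≤
      K (b₁ && b₁') (b₂ && b₂') * N (b₁ || b₁') (b₂ || b₂') := fun b₁ b₂ b₁' b₂' =>
    cellBlock_mul_le C (fun W => ν W * cO W * Aw W) (fun W => ν W * cO W * A W)
      (fun W => ν W * cO W * A W) (fun W => ν W * cO W * Aw W) a b b₁ b₂ b₁' b₂'
      hNw0 hKw0 hKw0 hNw0 pNK
  have dNL1 := holleyBlock_D_nonneg (L false false) (L false true) (L true false) (L true true)
    (N false false) (N false true) (N true false) (N true true) (hL0 _ _) (hL0 _ _) (hL0 _ _)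
    (hL0 _ _) (hN0 _ _) H1
    (by simpa using holNL false false true false) (by simpa using holNL false true true true)
    (by simpa using holNL false false true true) (by simpa using holNL false true true false)
  have dNL2 := holleyBlock_D_nonneg (L false false) (L true false) (L false true) (L true true)
    (N false false) (N true false) (N false true) (N true true) (hL0 _ _) (hL0 _ _) (hL0 _ _)
    (hL0 _ _) (hN0 _ _) (by linarith [H1])
    (by simpa using holNL false false false true) (by simpa using holNL true false true true)
    (by simpa using holNL false false true true) (by simpa using holNL true false false true)
  have dNK1 := holleyBlock_D_nonneg (K false false) (K false true) (K true false) (K true true)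
    (N false false) (N false true) (N true false) (N true true) (hK0 _ _) (hK0 _ _) (hK0 _ _)
    (hK0 _ _) (hN0 _ _) H1K
    (by simpa using holNK false false true false) (by simpa using holNK false true true true)
    (by simpa using holNK false false true true) (by simpa using holNK false true true false)
  have dNK2 := holleyBlock_D_nonneg (K false false) (K true false) (K false true) (K true true)
    (N false false) (N true false) (N false true) (N true true) (hK0 _ _) (hK0 _ _) (hK0 _ _)
    (hK0 _ _) (hN0 _ _) (by linarith [H1K])
    (by simpa using holNK false false false true) (by simpa using holNK true false true true)
    (by simpa using holNK false false true true) (by simpa using holNK true false false true)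
  have hD1 : (L true false + L true true + (K true false + K true true)) *
      (N false false + N false true + N true false + N true true) ≤
      (L false false + L false true + L true false + L true true +
        (K false false + K false true + K true false + K true true)) *
        (N true false + N true true) := by
    linarith [dNL1, dNK1]
  have hD2 : (L false true + L true true + (K false true + K true true)) *
      (N false false + N false true + N true false + N true true) ≤
      (L false false + L false true + L true false + L true true +
        (K false false + K false true + K true false + K true true)) *
        (N false true + N true true) := by
    linarith [dNL2, dNK2]
  have key := mixBlock_nonneg (L false false) (L false true) (L true false) (L true true)
    (L false false) (L false true) (L true false) (L true true)
    (K false false) (K false true) (K true false) (K true true)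
    (N false false) (N false true) (N true false) (N true true)
    (hL0 _ _) (hL0 _ _) (hL0 _ _) (hL0 _ _) (hK0 _ _) (hK0 _ _) (hK0 _ _) (hK0 _ _)
    (hL0 _ _) (hL0 _ _) (hL0 _ _) (hN0 _ _) (hN0 _ _) (hN0 _ _) (hN0 _ _)
    le_rfl le_rfl rfl H1 H1 X1a X1b X2a X2b H2N hD1 hD2
  -- the seven sums split and their blocks
  have eR0 : ∑ W ∈ C.powerset, ν W * A W =
      ∑ W ∈ C.powerset, ν W * cC W * A W + ∑ W ∈ C.powerset, ν W * cO W * A W := by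
    rw [← Finset.sum_add_distrib]
    exact Finset.sum_congr rfl fun W _ => hsplitR W
  have eR1 : ∑ W ∈ C.powerset, ν W * A W * (if a ∈ W then (1 : R) else 0) =
      ∑ W ∈ C.powerset, ν W * cC W * A W * (if a ∈ W then (1 : R) else 0) +
        ∑ W ∈ C.powerset, ν W * cO W * A W * (if a ∈ W then (1 : R) else 0) := by
    rw [← Finset.sum_add_distrib]
    exact Finset.sum_congr rfl fun W _ => by rw [hsplitR W]; ring
  have eR2 : ∑ W ∈ C.powerset, ν W * A W * (if b ∈ W then (1 : R) else 0) =
      ∑ W ∈ C.powerset, ν W * cC W * A W * (if b ∈ W then (1 : R) else 0) +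
        ∑ W ∈ C.powerset, ν W * cO W * A W * (if b ∈ W then (1 : R) else 0) := by
    rw [← Finset.sum_add_distrib]
    exact Finset.sum_congr rfl fun W _ => by rw [hsplitR W]; ring
  have eG0 : ∑ W ∈ C.powerset, ν W * G W =
      ∑ W ∈ C.powerset, ν W * cC W * A W + ∑ W ∈ C.powerset, ν W * cO W * Aw W := by
    rw [← Finset.sum_add_distrib]
    exact Finset.sum_congr rfl fun W _ => hsplitG W
  have eG1 : ∑ W ∈ C.powerset, ν W * G W * (if a ∈ W then (1 : R) else 0) =
      ∑ W ∈ C.powerset, ν W * cC W * A W * (if a ∈ W then (1 : R) else 0) +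
        ∑ W ∈ C.powerset, ν W * cO W * Aw W * (if a ∈ W then (1 : R) else 0) := by
    rw [← Finset.sum_add_distrib]
    exact Finset.sum_congr rfl fun W _ => by rw [hsplitG W]; ring
  have eG2 : ∑ W ∈ C.powerset, ν W * G W * (if b ∈ W then (1 : R) else 0) =
      ∑ W ∈ C.powerset, ν W * cC W * A W * (if b ∈ W then (1 : R) else 0) +
        ∑ W ∈ C.powerset, ν W * cO W * Aw W * (if b ∈ W then (1 : R) else 0) := by
    rw [← Finset.sum_add_distrib]
    exact Finset.sum_congr rfl fun W _ => by rw [hsplitG W]; ring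
  have eG12 : ∑ W ∈ C.powerset, ν W * G W *
      ((if a ∈ W then (1 : R) else 0) * (if b ∈ W then (1 : R) else 0)) =
      ∑ W ∈ C.powerset, ν W * cC W * A W *
        ((if a ∈ W then (1 : R) else 0) * (if b ∈ W then (1 : R) else 0)) +
        ∑ W ∈ C.powerset, ν W * cO W * Aw W *
          ((if a ∈ W then (1 : R) else 0) * (if b ∈ W then (1 : R) else 0)) := by
    rw [← Finset.sum_add_distrib]
    exact Finset.sum_congr rfl fun W _ => by rw [hsplitG W]; ring
  have eΛc := sum_split_four C (fun W => ν W * cC W * A W) a b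
  have eΛo := sum_split_four C (fun W => ν W * cO W * A W) a b
  have eF1c := sum_split_fst C (fun W => ν W * cC W * A W) a b
  have eF1o := sum_split_fst C (fun W => ν W * cO W * A W) a b
  have eF2c := sum_split_snd C (fun W => ν W * cC W * A W) a b
  have eF2o := sum_split_snd C (fun W => ν W * cO W * A W) a b
  have eMo := sum_split_four C (fun W => ν W * cO W * Aw W) a b
  have eXo := sum_split_fst C (fun W => ν W * cO W * Aw W) a b
  have eYo := sum_split_snd C (fun W => ν W * cO W * Aw W) a b
  have eXYc := sum_split_both C (fun W => ν W * cC W * A W) a b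
  have eXYo := sum_split_both C (fun W => ν W * cO W * Aw W) a b
  simp only [hLdef, hKdef, hNdef] at key
  simp only [hνdef, hAdef, hAw, hcC, hcO] at key
  simp only [hνdef, hAdef, hGdef, hAw, hcC, hcO] at eR0 eR1 eR2 eG0 eG1 eG2 eG12
  simp only [hνdef, hAdef, hcC, hcO] at eΛc eΛo eF1c eF1o eF2c eF2o
  simp only [hνdef, hAdef, hAw, hcC, hcO] at eMo eXo eYo eXYc eXYo
  rw [eR0, eR1, eR2, eG0, eG1, eG2, eG12, eΛc, eΛo, eF1c, eF1o, eF2c, eF2o, eMo, eXo, eYo, eXYc,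
    eXYo]
  exact key

end AnyArc

end Summit.Ventures.PercRepro2.Coin
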